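import Summits.Ventures.Crystal3D.Theorems.StickyWulffConstantNoReconstructionGainCellFluxDefs
import HarnessLib

/-!
# CellFlux glue: the covering lemma (CF2) and «local lemma ⇒ blanket bound»

HONEST FRAMING. Part of the venture `Summits/Ventures/Crystal3D` (cell `crystal3d-full`), helper
`--supports` the crux `NoReconstructionGain` (stmt-Ventures-19144, route
`route-Ventures-StickyWulffConstant`).  Planner cf-p1's CELLFLUX architecture (gen 15,
`…CellFluxDefs`): the provable glue, proved —

* `shadowCovering` — **(CF2)** for `a, κ > 0`: `2 · S_ν(x; a) ≤ Σᵢ τᵢ(ν)`.  Over every point of the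
  shadow, the body whose top is highest has a FREE top point there (a point strictly inside another
  open body lies strictly below that body's top), so the shadow slab lies in `⋃ᵢ upperFreeSlab i`, and
  symmetrically in `⋃ᵢ lowerFreeSlab i`; add the two measure inequalities;
* `blanketOfLocalFlux` — `BlanketOfLocalFlux a κ` (shadow monotone in the radius, (CF2), the
  term-wise local bound, handshake `Σ degᵢ = 2 C`);
* `blanketOfPoolFlux` — `BlanketOfPoolFlux a κ` (the POOL handshake `Σᵢ eᵢ ≤ 0`:
  `Σ e⁺ ≤ Σⱼ degⱼ · e⁻ⱼ/degⱼ ≤ Σ e⁻`, by `mem_contactNeighbors_comm`).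

So, in the kernel: `PoolFluxBound a κ` (`a ≥ 1/√3`, `a, κ > 0`) ⇒ `BlanketBound` ⇒ (`…BlanketGlue`)
`NoReconstructionGain` at `±e₃` for every coordination.

WHAT THIS IS NOT: the local lemma `PoolFluxBound fluxRadius 1` (censused by cf-p1/cf-p2, unproved);
rung F-C1 not moved.
-/

noncomputable section

namespace Summit.Ventures.Crystal3D.Theorems

open Summit.Ventures.Crystal3D Finset MeasureTheory
open Summit.Ventures.Crystal3D.Cruxes.NoReconstructionGain.CellFlux
open scoped InnerProductSpace

/-! ### Elementary geometry of the bodies -/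

/-- `lateralSq` is invariant under moving along the axis direction (`‖ν‖ = 1`). -/
theorem lateralSq_add_smul (ν c y : EuclideanSpace ℝ (Fin 3)) (hν : ‖ν‖ = 1) (s : ℝ) :
    lateralSq ν c (y + s • ν) = lateralSq ν c y := by
  unfold lateralSq
  have h1 : y + s • ν - c = (y - c) + s • ν := by abel
  rw [h1, norm_add_sq_real, inner_add_left, inner_smul_left, real_inner_self_eq_norm_sq, hν,
    norm_smul, Real.norm_eq_abs, hν, mul_one, inner_smul_right]
  simp only [conj_trivial, one_pow, mul_one, sq_abs]
  ring

/-- `lateralSq ≥ 0` (`‖ν‖ = 1`, Cauchy–Schwarz). -/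
theorem lateralSq_nonneg (ν c y : EuclideanSpace ℝ (Fin 3)) (hν : ‖ν‖ = 1) : 0 ≤ lateralSq ν c y := by
  unfold lateralSq
  have h := abs_real_inner_le_norm (y - c) ν
  rw [hν, mul_one] at h
  have := sq_le_sq' (abs_le.1 h).1 (abs_le.1 h).2
  nlinarith [this]

/-- The top point of the body at `c` over `y` lies on the vertical line through `y`:
`topPoint = y + (κ √(a² − L) − ⟪y − c, ν⟫) • ν`. -/
theorem topPoint_eq (ν : EuclideanSpace ℝ (Fin 3)) (a κ : ℝ) (c y : EuclideanSpace ℝ (Fin 3)) :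
    topPoint ν a κ c y = y + (κ * Real.sqrt (a ^ 2 - lateralSq ν c y) - ⟪y - c, ν⟫_ℝ) • ν := by
  unfold topPoint lateral
  rw [sub_smul]
  abel

/-- The bottom point likewise: `bottomPoint = y + (−κ √(a² − L) − ⟪y − c, ν⟫) • ν`. -/
theorem bottomPoint_eq (ν : EuclideanSpace ℝ (Fin 3)) (a κ : ℝ) (c y : EuclideanSpace ℝ (Fin 3)) :
    bottomPoint ν a κ c y = y + (-(κ * Real.sqrt (a ^ 2 - lateralSq ν c y)) - ⟪y - c, ν⟫_ℝ) • ν := by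
  unfold bottomPoint lateral
  rw [sub_smul, neg_smul]
  abel

/-- Height of a point of the vertical line through `y`. -/
theorem inner_add_smul_self (ν y : EuclideanSpace ℝ (Fin 3)) (hν : ‖ν‖ = 1) (s : ℝ) :
    ⟪y + s • ν, ν⟫_ℝ = ⟪y, ν⟫_ℝ + s := by
  rw [inner_add_left, inner_smul_left, real_inner_self_eq_norm_sq, hν]; simp

/-- Inside an open body, the height is strictly between the bottom and the top of the body over that
lateral position: from `L/a² + t²/(κa)² < 1` (`a, κ > 0`) we get `L < a²` and `|t| < κ √(a² − L)`. -/
theorem inOpenBody_bounds (a κ L t : ℝ) (ha : 0 < a) (hκ : 0 < κ)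
    (h : L / a ^ 2 + t ^ 2 / (κ * a) ^ 2 < 1) :
    L < a ^ 2 ∧ |t| < κ * Real.sqrt (a ^ 2 - L) := by
  have ha2 : 0 < a ^ 2 := by positivity
  have hκa : 0 < (κ * a) ^ 2 := by positivity
  have h1 : L * κ ^ 2 + t ^ 2 < κ ^ 2 * a ^ 2 := by
    have := h
    rw [div_add_div _ _ ha2.ne' hκa.ne', div_lt_one (by positivity)] at this
    nlinarith [this]
  have hLa : L < a ^ 2 := by nlinarith [sq_nonneg t, hκ]
  refine ⟨hLa, ?_⟩
  have hs : 0 ≤ κ * Real.sqrt (a ^ 2 - L) := by positivity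
  have hsq : (κ * Real.sqrt (a ^ 2 - L)) ^ 2 = κ ^ 2 * (a ^ 2 - L) := by
    rw [mul_pow, Real.sq_sqrt (by linarith)]
  have ht2 : t ^ 2 < (κ * Real.sqrt (a ^ 2 - L)) ^ 2 := by rw [hsq]; nlinarith [h1]
  exact abs_lt_of_sq_lt_sq' ht2 hs |> fun h => abs_lt.2 h

/-! ### (CF2) the covering lemma -/

/-- Every point of the shadow slab lies in the upper free slab of the body whose top over it is
highest. -/
theorem shadowSlab_subset_iUnion_upperFreeSlab (ν : EuclideanSpace ℝ (Fin 3)) (hν : ‖ν‖ = 1)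
    (a κ : ℝ) (ha : 0 < a) (hκ : 0 < κ) {N : ℕ} (x : Fin N → EuclideanSpace ℝ (Fin 3)) :
    shadowSlab ν a x ⊆ ⋃ i, upperFreeSlab ν a κ x i := by
  classical
  intro y hy
  obtain ⟨⟨i₁, hi₁⟩, hyν⟩ := hy
  -- the bodies over `y` and the highest top among them
  set I := (univ : Finset (Fin N)).filter fun i => lateralSq ν (x i) y ≤ a ^ 2 with hI
  set H : Fin N → ℝ := fun i => ⟪x i, ν⟫_ℝ + κ * Real.sqrt (a ^ 2 - lateralSq ν (x i) y) with hH
  have hIne : I.Nonempty := ⟨i₁, mem_filter.2 ⟨mem_univ _, hi₁⟩⟩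
  obtain ⟨i₀, hi₀I, hmax⟩ := exists_max_image I H hIne
  have hi₀ : lateralSq ν (x i₀) y ≤ a ^ 2 := (mem_filter.1 hi₀I).2
  refine Set.mem_iUnion.2 ⟨i₀, hi₀, hyν, fun j _ hj => ?_⟩
  -- the top point of `i₀` over `y`
  set s := κ * Real.sqrt (a ^ 2 - lateralSq ν (x i₀) y) - ⟪y - x i₀, ν⟫_ℝ with hs
  have htop : topPoint ν a κ (x i₀) y = y + s • ν := topPoint_eq ν a κ (x i₀) y
  unfold InOpenBody at hj
  rw [htop, lateralSq_add_smul ν (x j) y hν s] at hj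
  have hheight : ⟪y + s • ν - x j, ν⟫_ℝ = H i₀ - ⟪x j, ν⟫_ℝ := by
    rw [inner_sub_left, inner_add_smul_self ν y hν s, hs, hH, inner_sub_left]; ring
  rw [hheight] at hj
  obtain ⟨hLj, ht⟩ := inOpenBody_bounds a κ _ _ ha hκ hj
  have hjI : j ∈ I := mem_filter.2 ⟨mem_univ _, hLj.le⟩
  have := hmax j hjI
  have ht' := (abs_lt.1 ht).2
  simp only [hH] at this
  linarith

/-- Every point of the shadow slab lies in the lower free slab of the body whose bottom over it is
lowest. -/
theorem shadowSlab_subset_iUnion_lowerFreeSlab (ν : EuclideanSpace ℝ (Fin 3)) (hν : ‖ν‖ = 1)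
    (a κ : ℝ) (ha : 0 < a) (hκ : 0 < κ) {N : ℕ} (x : Fin N → EuclideanSpace ℝ (Fin 3)) :
    shadowSlab ν a x ⊆ ⋃ i, lowerFreeSlab ν a κ x i := by
  classical
  intro y hy
  obtain ⟨⟨i₁, hi₁⟩, hyν⟩ := hy
  set I := (univ : Finset (Fin N)).filter fun i => lateralSq ν (x i) y ≤ a ^ 2 with hI
  set H : Fin N → ℝ := fun i => ⟪x i, ν⟫_ℝ - κ * Real.sqrt (a ^ 2 - lateralSq ν (x i) y) with hH
  have hIne : I.Nonempty := ⟨i₁, mem_filter.2 ⟨mem_univ _, hi₁⟩⟩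
  obtain ⟨i₀, hi₀I, hmin⟩ := exists_min_image I H hIne
  have hi₀ : lateralSq ν (x i₀) y ≤ a ^ 2 := (mem_filter.1 hi₀I).2
  refine Set.mem_iUnion.2 ⟨i₀, hi₀, hyν, fun j _ hj => ?_⟩
  set s := -(κ * Real.sqrt (a ^ 2 - lateralSq ν (x i₀) y)) - ⟪y - x i₀, ν⟫_ℝ with hs
  have hbot : bottomPoint ν a κ (x i₀) y = y + s • ν := bottomPoint_eq ν a κ (x i₀) y
  unfold InOpenBody at hj
  rw [hbot, lateralSq_add_smul ν (x j) y hν s] at hj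
  have hheight : ⟪y + s • ν - x j, ν⟫_ℝ = H i₀ - ⟪x j, ν⟫_ℝ := by
    rw [inner_sub_left, inner_add_smul_self ν y hν s, hs, hH, inner_sub_left]; ring
  rw [hheight] at hj
  obtain ⟨hLj, ht⟩ := inOpenBody_bounds a κ _ _ ha hκ hj
  have hjI : j ∈ I := mem_filter.2 ⟨mem_univ _, hLj.le⟩
  have := hmin j hjI
  have ht' := (abs_lt.1 ht).1
  simp only [hH] at this
  linarith

/-- A free slab is bounded: it lies in the ball of radius `2 Σ ‖x m‖ + |a| + 1/2`. -/
theorem lateral_slab_subset_closedBall (ν : EuclideanSpace ℝ (Fin 3)) (hν : ‖ν‖ = 1) (a : ℝ) {N : ℕ}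
    (x : Fin N → EuclideanSpace ℝ (Fin 3)) (i : Fin N) :
    {y : EuclideanSpace ℝ (Fin 3) | lateralSq ν (x i) y ≤ a ^ 2 ∧ |⟪y, ν⟫_ℝ| ≤ 1 / 2} ⊆
      Metric.closedBall (0 : EuclideanSpace ℝ (Fin 3)) (2 * ∑ m, ‖x m‖ + |a| + 1 / 2) := by
  rintro y ⟨hL, hy⟩
  rw [Metric.mem_closedBall, dist_zero_right]
  unfold lateralSq at hL
  have h1 : |⟪y - x i, ν⟫_ℝ| ≤ 1 / 2 + ‖x i‖ := by
    rw [inner_sub_left]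
    have := abs_real_inner_le_norm (x i) ν
    rw [hν, mul_one] at this
    have := abs_sub (⟪y, ν⟫_ℝ) (⟪x i, ν⟫_ℝ)
    linarith
  have h2 : ‖y - x i‖ ≤ |a| + (1 / 2 + ‖x i‖) := by
    have hsq : ‖y - x i‖ ^ 2 ≤ (|a| + (1 / 2 + ‖x i‖)) ^ 2 := by
      have habs : ⟪y - x i, ν⟫_ℝ ^ 2 ≤ (1 / 2 + ‖x i‖) ^ 2 := by
        rw [← sq_abs]; exact pow_le_pow_left₀ (abs_nonneg _) h1 2
      have haa : a ^ 2 = |a| ^ 2 := (sq_abs a).symm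
      nlinarith [norm_nonneg (x i), abs_nonneg a]
    exact (abs_le_of_sq_le_sq' hsq (by positivity)).2
  have h3 : ‖x i‖ ≤ ∑ m, ‖x m‖ := single_le_sum (fun m _ => norm_nonneg (x m)) (mem_univ i)
  calc ‖y‖ = ‖(y - x i) + x i‖ := by rw [sub_add_cancel]
    _ ≤ ‖y - x i‖ + ‖x i‖ := norm_add_le _ _
    _ ≤ 2 * ∑ m, ‖x m‖ + |a| + 1 / 2 := by linarith

/-- **(CF2) `ShadowCovering`** for positive semi-axes: `2 · S_ν(x; a) ≤ Σᵢ τᵢ(ν)`. -/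
theorem shadowCovering : ∀ a κ : ℝ, 0 < a → 0 < κ →
    Summit.Ventures.Crystal3D.Cruxes.NoReconstructionGain.CellFlux.ShadowCovering a κ := by
  intro a κ ha hκ N x ν hν
  have hsubU : ∀ i, upperFreeSlab ν a κ x i ⊆
      {y : EuclideanSpace ℝ (Fin 3) | lateralSq ν (x i) y ≤ a ^ 2 ∧ |⟪y, ν⟫_ℝ| ≤ 1 / 2} :=
    fun i y hy => ⟨hy.1, hy.2.1⟩
  have hsubL : ∀ i, lowerFreeSlab ν a κ x i ⊆
      {y : EuclideanSpace ℝ (Fin 3) | lateralSq ν (x i) y ≤ a ^ 2 ∧ |⟪y, ν⟫_ℝ| ≤ 1 / 2} :=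
    fun i y hy => ⟨hy.1, hy.2.1⟩
  have hfinU : ∀ i, volume (upperFreeSlab ν a κ x i) ≠ ⊤ := fun i =>
    (lt_of_le_of_lt (measure_mono ((hsubU i).trans (lateral_slab_subset_closedBall ν hν a x i)))
      measure_closedBall_lt_top).ne
  have hfinL : ∀ i, volume (lowerFreeSlab ν a κ x i) ≠ ⊤ := fun i =>
    (lt_of_le_of_lt (measure_mono ((hsubL i).trans (lateral_slab_subset_closedBall ν hν a x i)))
      measure_closedBall_lt_top).ne
  have hU : volume (shadowSlab ν a x) ≤ ∑ i, volume (upperFreeSlab ν a κ x i) :=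
    (measure_mono (shadowSlab_subset_iUnion_upperFreeSlab ν hν a κ ha hκ x)).trans
      (measure_iUnion_fintype_le _ _)
  have hL : volume (shadowSlab ν a x) ≤ ∑ i, volume (lowerFreeSlab ν a κ x i) :=
    (measure_mono (shadowSlab_subset_iUnion_lowerFreeSlab ν hν a κ ha hκ x)).trans
      (measure_iUnion_fintype_le _ _)
  have hUfin : ∑ i, volume (upperFreeSlab ν a κ x i) ≠ ⊤ := ENNReal.sum_ne_top.2 fun i _ => hfinU i
  have hLfin : ∑ i, volume (lowerFreeSlab ν a κ x i) ≠ ⊤ := ENNReal.sum_ne_top.2 fun i _ => hfinL i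
  have hU' := ENNReal.toReal_mono hUfin hU
  have hL' := ENNReal.toReal_mono hLfin hL
  rw [ENNReal.toReal_sum (fun i _ => hfinU i)] at hU'
  rw [ENNReal.toReal_sum (fun i _ => hfinL i)] at hL'
  unfold shadowArea cellFlux
  rw [sum_add_distrib]
  linarith

/-! ### Glue: local lemmas ⇒ blanket bound -/

/-- The shadow area is monotone in the radius (`0 ≤ r ≤ a`). -/
theorem shadowArea_mono (ν : EuclideanSpace ℝ (Fin 3)) (hν : ‖ν‖ = 1) {r a : ℝ} (hr : 0 ≤ r)
    (hra : r ≤ a) {N : ℕ} (x : Fin N → EuclideanSpace ℝ (Fin 3)) :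
    shadowArea ν r x ≤ shadowArea ν a x := by
  unfold shadowArea
  have hsub : shadowSlab ν r x ⊆ shadowSlab ν a x := by
    rintro y ⟨⟨i, hi⟩, hy⟩
    exact ⟨⟨i, hi.trans (pow_le_pow_left₀ hr hra 2)⟩, hy⟩
  have hfin : volume (shadowSlab ν a x) ≠ ⊤ := by
    have hsub' : shadowSlab ν a x ⊆ ⋃ i : Fin N,
        {y : EuclideanSpace ℝ (Fin 3) | lateralSq ν (x i) y ≤ a ^ 2 ∧ |⟪y, ν⟫_ℝ| ≤ 1 / 2} := by
      rintro y ⟨⟨i, hi⟩, hy⟩; exact Set.mem_iUnion.2 ⟨i, hi, hy⟩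
    refine (lt_of_le_of_lt (measure_mono hsub') ?_).ne
    refine lt_of_le_of_lt (measure_iUnion_fintype_le _ _) ?_
    refine ENNReal.sum_lt_top.2 fun i _ => ?_
    exact lt_of_le_of_lt (measure_mono (lateral_slab_subset_closedBall ν hν a x i))
      measure_closedBall_lt_top
  exact ENNReal.toReal_mono hfin (measure_mono hsub)

/-- The blanket radius is nonnegative. -/
theorem blanketRadius_nonneg : 0 ≤ blanketRadius := by
  unfold blanketRadius; positivity

/-- **`BlanketOfLocalFlux a κ`** (glue; cf-p1 g15): monotonicity of the shadow, the covering lemma,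
the term-wise local bound and the handshake `Σ degᵢ = 2 C(x)` give the blanket bound. -/
theorem blanketOfLocalFlux : ∀ a κ : ℝ,
    Summit.Ventures.Crystal3D.Cruxes.NoReconstructionGain.CellFlux.BlanketOfLocalFlux a κ := by
  intro a κ hr hSC hLF N x hx ν hν
  have h1 := shadowArea_mono ν hν blanketRadius_nonneg hr x
  have h2 := hSC N x ν hν
  have h3 : ∀ i, 2 * Real.sqrt 3 * cellFlux ν a κ x i ≤ 12 - (coordination x i : ℝ) :=
    fun i => hLF (coordination x i) N x hx ν hν i rfl
  have h4 : ∑ i, (2 * Real.sqrt 3 * cellFlux ν a κ x i) ≤ ∑ i, (12 - (coordination x i : ℝ)) :=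
    sum_le_sum fun i _ => h3 i
  rw [← mul_sum] at h4
  rw [sum_sub_distrib, sum_const, card_univ, Fintype.card_fin, nsmul_eq_mul] at h4
  have h5 : ∑ i, (coordination x i : ℝ) = 2 * (numContacts x : ℝ) := by
    exact_mod_cast sum_coordination_eq x
  rw [h5] at h4
  have h3pos : 0 ≤ Real.sqrt 3 := Real.sqrt_nonneg 3
  nlinarith [h1, h2, h4, h3pos, mul_le_mul_of_nonneg_left h1 h3pos,
    mul_le_mul_of_nonneg_left h2 h3pos]

/-- The POOL handshake: summing the pool inequalities gives `Σᵢ eᵢ ≤ 0`. -/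
theorem sum_excess_nonpos_of_pool {a κ : ℝ} {N : ℕ} (x : Fin N → EuclideanSpace ℝ (Fin 3))
    (ν : EuclideanSpace ℝ (Fin 3))
    (hpool : ∀ i, max (excess ν a κ x i) 0 ≤
      ∑ j ∈ contactNeighbors x i, max (-excess ν a κ x j) 0 / (coordination x j : ℝ)) :
    ∑ i, excess ν a κ x i ≤ 0 := by
  classical
  set e := fun i => excess ν a κ x i with he
  -- swap the double sum: every share of `j` is used by exactly `deg j` neighbours
  have hswap : ∑ i, ∑ j ∈ contactNeighbors x i, max (-e j) 0 / (coordination x j : ℝ) =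
      ∑ j, (coordination x j : ℝ) * (max (-e j) 0 / (coordination x j : ℝ)) := by
    rw [sum_comm' (t' := univ) (s' := fun j => contactNeighbors x j)]
    · refine sum_congr rfl fun j _ => ?_
      rw [sum_const, nsmul_eq_mul]; rfl
    · intro i j
      simp only [mem_univ, true_and, and_true]
      exact mem_contactNeighbors_comm x
  have hshare : ∀ j, (coordination x j : ℝ) * (max (-e j) 0 / (coordination x j : ℝ)) ≤ max (-e j) 0 := by
    intro j
    by_cases h0 : (coordination x j : ℝ) = 0
    · rw [h0, zero_mul]; exact le_max_right _ _
    · rw [mul_div_cancel₀ _ h0]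
  have hsum : ∑ i, max (e i) 0 ≤ ∑ j, max (-e j) 0 :=
    calc ∑ i, max (e i) 0 ≤ ∑ i, ∑ j ∈ contactNeighbors x i, max (-e j) 0 / (coordination x j : ℝ) :=
          sum_le_sum fun i _ => hpool i
      _ = ∑ j, (coordination x j : ℝ) * (max (-e j) 0 / (coordination x j : ℝ)) := hswap
      _ ≤ ∑ j, max (-e j) 0 := sum_le_sum fun j _ => hshare j
  have hdecomp : ∀ i, e i = max (e i) 0 - max (-e i) 0 := fun i => by
    rcases le_total 0 (e i) with h | h
    · rw [max_eq_left h, max_eq_right (by linarith)]; ring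
    · rw [max_eq_right h, max_eq_left (by linarith)]; ring
  calc ∑ i, excess ν a κ x i = ∑ i, (max (e i) 0 - max (-e i) 0) := sum_congr rfl fun i _ => hdecomp i
    _ = ∑ i, max (e i) 0 - ∑ i, max (-e i) 0 := sum_sub_distrib _ _
    _ ≤ 0 := by linarith

/-- **`BlanketOfPoolFlux a κ`** (glue; cf-p1 g15): the covering lemma and the POOL local lemma give
the blanket bound (the `d = 0` hypothesis of the target is not even needed). -/
theorem blanketOfPoolFlux : ∀ a κ : ℝ,
    Summit.Ventures.Crystal3D.Cruxes.NoReconstructionGain.CellFlux.BlanketOfPoolFlux a κ := by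
  intro a κ hr hSC _ hPool N x hx ν hν
  have h1 := shadowArea_mono ν hν blanketRadius_nonneg hr x
  have h2 := hSC N x ν hν
  have h3 := sum_excess_nonpos_of_pool x ν (hPool N x hx ν hν)
  have h4 : ∑ i, excess ν a κ x i =
      2 * Real.sqrt 3 * ∑ i, cellFlux ν a κ x i - (12 * (N : ℝ) - 2 * (numContacts x : ℝ)) := by
    unfold excess
    rw [sum_sub_distrib, ← mul_sum, sum_sub_distrib, sum_const, card_univ, Fintype.card_fin,
      nsmul_eq_mul]
    have h5 : ∑ i, (coordination x i : ℝ) = 2 * (numContacts x : ℝ) := by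
      exact_mod_cast sum_coordination_eq x
    rw [h5]; ring
  have h3pos : 0 ≤ Real.sqrt 3 := Real.sqrt_nonneg 3
  nlinarith [h1, h2, h3, h4, mul_le_mul_of_nonneg_left h1 h3pos, mul_le_mul_of_nonneg_left h2 h3pos]

end Summit.Ventures.Crystal3D.Theorems
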